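import Summits.BirchSwinnertonDyer.Rank1Residual.X2.CongruenceTransferForms
import Summits.BirchSwinnertonDyer.Rank1Residual.X2.CongruentLambdaShiftDerived
import HarnessLib

/-!
# Route G between two GOOD-ORDINARY Eisenstein members WITHOUT the typed input: the transferred
# invariants, Mazur's main conjecture and `BSD(E₀, p)` on the X1 leaf from a closed leaf relative,
# with the shift `e = Σ_{ℓ∈Σ₀} (δ_{E'}^{(ℓ)} − δ_E^{(ℓ)})` DERIVED (Greenberg–Vatsal 2000, Thm. (1.4))

HONEST FRAMING (BSD rank-`≤ 1` residual cell `b2b-bsdres`, home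
`run/shared/lean/b2b/bsd-rank1-residual/`, unit `b2b-bsdres-eisenstein-p2`, classes X2/X1; research
route, no claim beyond stated classes; nothing booked here; labels unchanged): the cell deletes the
COMBINATION-SHAPED residual classes of the rank-`≤ 1` BSD formula from PUBLISHED theorems only and
TYPES the construction-shaped ones; this is not "finishing BSD". Theorems only (no definition, no
named fact, nothing asserted). The `_of_facts` forms of gen 7's route-G theorems
(`X2/CongruenceTransfer.lean`, `X2/CongruenceTransferForms.lean`) for a target AND a relative that
are both GOOD ORDINARY at `p` (X1-leaf ↔ X1-leaf congruences; X2's good-ordinary partners): the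
hypothesis `hG : CongruentLambdaShift W W' p e` — so far a TYPED per-pair input supplied by the
census — is REPLACED by the kernel theorem
`CongruentLambdaShiftDerived.congruentLambdaShift_of_facts`, i.e. by the three PRINTED statements
`imKummer_ge_greenbergCondition_at_p` (GV p. 26 / Greenberg Props. 2.2–2.4),
`lambda_nonPrimitive_eq_add_sum_delta` (GV (7)), `divisible_nonPrimitiveSelmerInfty_of_mu_eq_zero`
(GV p. 8 / Prop. (2.5)) and the explicit shift `e = Σ_{v∈Σ₀} (δ W' p v − δ W p v)`
(`GreenbergVatsal2000.delta`; per pair by `X2/LocalDeltaCalculus`).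

* `algebraicInvariantsEq_of_torsionIso_goodOrd_of_facts` — `(μ, λ)(E₀) = (0, k)` from ANY
  good-ordinary relative `E₀'` with `AlgebraicInvariantsEq W' p k'`, `E₀[p] ≅ E₀'[p]`,
  `k = k' + Σ (δ' − δ)`;
* `algebraicInvariantsEq_of_closedLeafRelative_of_facts` — the same with the relative CLOSED by
  Mazur's main conjecture + `μ_an = 0`, `λ_an = n'` (`k' = n'`);
* `mazurMainConjecture_of_closedLeafRelative_of_facts` — Mazur's MC at the target (both ranks);
* `Leaf.bsdp_of_closedLeafRelative_of_facts` — `BSD(E₀, p)` on the X1 leaf (`r_an = 0`).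

Remaining named-fact inputs of these theorems (all PUBLISHED, all pre-existing in the tree):
Wuthrich 2014 Thm. 16 in the form `charIdeal_dvd_padicLFunction` (Kato's divisibility at a
reducible good ordinary `p`), modularity data, Greenberg's characteristic-value formula and GZK for
the BSD form, and the three GV 2000 statements above. MIXED and MULT route-G pairs (a `p ‖ N`
member) keep the typed `CongruentLambdaShift` (gen 7's theorems): GV's (7)/(2.5) are printed for good
ordinary `p`.

References: R. Greenberg, V. Vatsal, Invent. Math. 142 (2000): Thm. (1.4), §1 (7) p. 8, §2
pp. 26–27; R. Greenberg, LNM 1716 (1999), Thm. 4.1; C. Wuthrich, Doc. Math. 19 (2014), Thm. 16.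
-/

noncomputable section

open scoped Classical MatrixGroups ModularForm

open PowerSeries CongruenceSubgroup WeierstrassCurve NumberField IsDedekindDomain
  Literature.NumberTheory.EllipticCurves
  Literature.NumberTheory.EllipticCurves.ModularForms
  Literature.NumberTheory.EllipticCurves.Rank1Residual
  Literature.NumberTheory.EllipticCurves.Rank1Residual.Typed
  Literature.NumberTheory.EllipticCurves.Wuthrich2014
  Literature.NumberTheory.EllipticCurves.SteinWuthrich2013
  Literature.NumberTheory.EllipticCurves.Greenberg1999
  Literature.NumberTheory.EllipticCurves.GreenbergVatsal2000
  Summit.BirchSwinnertonDyer.BirchSwinnertonDyer.Theorems.Rank1ResidualX1Defs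
  Summit.BirchSwinnertonDyer.Rank1Residual.X1.MuLambda
  Summit.BirchSwinnertonDyer.Rank1Residual.X1.MuPart
  Summit.BirchSwinnertonDyer.Rank1Residual.X1.ParitySqueeze
  Summit.BirchSwinnertonDyer.Rank1Residual.X1.TamagawaSqueeze
  Summit.BirchSwinnertonDyer.Rank1Residual.X1.CongruenceTransfer
  Summit.BirchSwinnertonDyer.Rank1Residual.X2.CongruentLambdaShiftDerived

namespace Summit.BirchSwinnertonDyer.Rank1Residual.X2

section GoodOrdinaryRelative

variable {W W' : WeierstrassCurve ℚ} [W.IsElliptic] [W.IsGloballyMinimal] [W'.IsElliptic]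
  [W'.IsGloballyMinimal] {p : ℕ} [Fact p.Prime] (S₀ : Finset (HeightOneSpectrum (𝓞 ℚ)))

/-- **ROUTE G between two good-ordinary members, the shift DERIVED.** Target `(E₀, p)`: `p ≠ 2` good
ordinary, `E₀[p]` reducible, `μ_an(E₀) = 0` (`X1.MuPart.AnalyticMuLE W p 0`; Wuthrich Thm. 16
`hW16`, modularity `hmod`). Relative `E₀'`: good ordinary at `p` with `AlgebraicInvariantsEq W' p k'`.
Congruence `E₀[p] ≅ E₀'[p]` (`TorsionIso`), `Σ₀ ∌ p` a finite set containing the bad primes of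
both, and `k = k' + Σ_{v∈Σ₀} (δ_{E₀'}^{(v)} − δ_{E₀}^{(v)})`. Then `AlgebraicInvariantsEq W p k` —
gen 7's `algebraicInvariantsEq_of_congruentLambdaShift_goodOrd` with its typed input
`CongruentLambdaShift W W' p e` supplied by `congruentLambdaShift_of_facts` (GV facts `hGV`, `hA`,
`hB`). [cite: GreenbergVatsal2000, Thm. (1.4), §1 (7) p. 8, §2 pp. 26–27]
[cite: Wuthrich2014, Thm. 16 (p. 397)] -/
theorem algebraicInvariantsEq_of_torsionIso_goodOrd_of_facts
    (hGV : imKummer_ge_greenbergCondition_at_p) (hA : lambda_nonPrimitive_eq_add_sum_delta)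
    (hB : divisible_nonPrimitiveSelmerInfty_of_mu_eq_zero)
    (hW16 : Wuthrich2014.charIdeal_dvd_padicLFunction) (hmod : nonempty_modularParametrizationData)
    (hp : p ≠ 2) (hgood : W.HasGoodReductionAtPrime p) (hord : ¬ (p : ℤ) ∣ W.frobeniusTrace p)
    (hred : ¬ W.HasIrreducibleModPGaloisRep p) (hμ0 : X1.MuPart.AnalyticMuLE W p 0)
    (hgood' : W'.HasGoodReductionAtPrime p) (hord' : ¬ (p : ℤ) ∣ W'.frobeniusTrace p)
    (hS₀ : ∀ v ∈ S₀, ((p : ℕ) : 𝓞 ℚ) ∉ v.asIdeal)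
    (hS : ∀ v : HeightOneSpectrum (𝓞 ℚ), v ∉ S₀ → ((p : ℕ) : 𝓞 ℚ) ∉ v.asIdeal →
      W.HasGoodReductionAt v)
    (hS' : ∀ v : HeightOneSpectrum (𝓞 ℚ), v ∉ S₀ → ((p : ℕ) : 𝓞 ℚ) ∉ v.asIdeal →
      W'.HasGoodReductionAt v)
    {k' : ℕ} (hinv' : AlgebraicInvariantsEq W' p k') (hiso : TorsionIso W W' p) {k : ℕ}
    (hk : (k : ℤ) = k' + ∑ v ∈ S₀, ((delta W' p v : ℤ) - (delta W p v : ℤ))) :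
    AlgebraicInvariantsEq W p k :=
  algebraicInvariantsEq_of_congruentLambdaShift_goodOrd hW16 hmod hp hgood hord hred hμ0 hinv' hiso
    (CongruentLambdaShiftDerived.congruentLambdaShift_of_facts W W' p S₀ hGV hA hB hp hgood hord
      hgood' hord' hS₀ hS hS') hk

/-- **ROUTE G with a CLOSED good-ordinary relative, the shift DERIVED.** As above, the relative
`(E₀', p)` being a good ordinary Eisenstein pair CLOSED by Mazur's main conjecture with `μ_an = 0`
and `λ_an = n'` (so `(μ, λ)(E₀') = (0, n')`, `algebraicInvariantsEq_of_mazurMainConjecture`);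
`k = n' + Σ_{v∈Σ₀} (δ' − δ)`. [cite: GreenbergVatsal2000, Thm. (1.4), §2 pp. 26–27]
[cite: Wuthrich2014, Thm. 16 (p. 397)] -/
theorem algebraicInvariantsEq_of_closedLeafRelative_of_facts
    (hGV : imKummer_ge_greenbergCondition_at_p) (hA : lambda_nonPrimitive_eq_add_sum_delta)
    (hB : divisible_nonPrimitiveSelmerInfty_of_mu_eq_zero)
    (hW16 : Wuthrich2014.charIdeal_dvd_padicLFunction) (hmod : nonempty_modularParametrizationData)
    (hp : p ≠ 2) (hgood : W.HasGoodReductionAtPrime p) (hord : ¬ (p : ℤ) ∣ W.frobeniusTrace p)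
    (hred : ¬ W.HasIrreducibleModPGaloisRep p) (hμ0 : X1.MuPart.AnalyticMuLE W p 0)
    (hgood' : W'.HasGoodReductionAtPrime p) (hord' : ¬ (p : ℤ) ∣ W'.frobeniusTrace p)
    (hred' : ¬ W'.HasIrreducibleModPGaloisRep p) (hMC' : MazurMainConjecture W' p) {n' : ℕ}
    (hμ0' : X1.MuPart.AnalyticMuLE W' p 0) (hlam' : X1.ParitySqueeze.AnalyticLambdaEq W' p n')
    (hS₀ : ∀ v ∈ S₀, ((p : ℕ) : 𝓞 ℚ) ∉ v.asIdeal)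
    (hS : ∀ v : HeightOneSpectrum (𝓞 ℚ), v ∉ S₀ → ((p : ℕ) : 𝓞 ℚ) ∉ v.asIdeal →
      W.HasGoodReductionAt v)
    (hS' : ∀ v : HeightOneSpectrum (𝓞 ℚ), v ∉ S₀ → ((p : ℕ) : 𝓞 ℚ) ∉ v.asIdeal →
      W'.HasGoodReductionAt v)
    (hiso : TorsionIso W W' p) {k : ℕ}
    (hk : (k : ℤ) = n' + ∑ v ∈ S₀, ((delta W' p v : ℤ) - (delta W p v : ℤ))) :
    AlgebraicInvariantsEq W p k :=
  algebraicInvariantsEq_of_torsionIso_goodOrd_of_facts S₀ hGV hA hB hW16 hmod hp hgood hord hred hμ0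
    hgood' hord' hS₀ hS hS'
    (algebraicInvariantsEq_of_mazurMainConjecture hW16 hmod W' p hp hgood' hord' hred' hMC' hμ0' hlam')
    hiso hk

/-- **Mazur's main conjecture at the target from a closed good-ordinary relative, the shift DERIVED**
(both ranks): with `λ_an(E₀) = n ≤ k = n' + Σ (δ' − δ)` the squeeze
`mazurMainConjecture_of_algebraicInvariantsEq` closes `(E₀, p)`.
[cite: GreenbergVatsal2000, Thm. (1.4), §2 pp. 26–27] [cite: Wuthrich2014, Thm. 16 (p. 397)] -/
theorem mazurMainConjecture_of_closedLeafRelative_of_facts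
    (hGV : imKummer_ge_greenbergCondition_at_p) (hA : lambda_nonPrimitive_eq_add_sum_delta)
    (hB : divisible_nonPrimitiveSelmerInfty_of_mu_eq_zero)
    (hW16 : Wuthrich2014.charIdeal_dvd_padicLFunction) (hmod : nonempty_modularParametrizationData)
    (hp : p ≠ 2) (hgood : W.HasGoodReductionAtPrime p) (hord : ¬ (p : ℤ) ∣ W.frobeniusTrace p)
    (hred : ¬ W.HasIrreducibleModPGaloisRep p) {n : ℕ} (hμ0 : X1.MuPart.AnalyticMuLE W p 0)
    (hlam : X1.ParitySqueeze.AnalyticLambdaEq W p n)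
    (hgood' : W'.HasGoodReductionAtPrime p) (hord' : ¬ (p : ℤ) ∣ W'.frobeniusTrace p)
    (hred' : ¬ W'.HasIrreducibleModPGaloisRep p) (hMC' : MazurMainConjecture W' p) {n' : ℕ}
    (hμ0' : X1.MuPart.AnalyticMuLE W' p 0) (hlam' : X1.ParitySqueeze.AnalyticLambdaEq W' p n')
    (hS₀ : ∀ v ∈ S₀, ((p : ℕ) : 𝓞 ℚ) ∉ v.asIdeal)
    (hS : ∀ v : HeightOneSpectrum (𝓞 ℚ), v ∉ S₀ → ((p : ℕ) : 𝓞 ℚ) ∉ v.asIdeal →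
      W.HasGoodReductionAt v)
    (hS' : ∀ v : HeightOneSpectrum (𝓞 ℚ), v ∉ S₀ → ((p : ℕ) : 𝓞 ℚ) ∉ v.asIdeal →
      W'.HasGoodReductionAt v)
    (hiso : TorsionIso W W' p) {k : ℕ}
    (hk : (k : ℤ) = n' + ∑ v ∈ S₀, ((delta W' p v : ℤ) - (delta W p v : ℤ))) (hn : n ≤ k) :
    MazurMainConjecture W p :=
  mazurMainConjecture_of_algebraicInvariantsEq hW16 hp hgood hord hred hμ0
    (algebraicInvariantsEq_of_closedLeafRelative_of_facts S₀ hGV hA hB hW16 hmod hp hgood hord hred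
      hμ0 hgood' hord' hred' hMC' hμ0' hlam' hS₀ hS hS' hiso hk) hlam hn

end GoodOrdinaryRelative

section Leaf

variable {W W' : WeierstrassCurve ℚ} [W.IsElliptic] [W.IsGloballyMinimal] [W'.IsElliptic]
  [W'.IsGloballyMinimal] {p : ℕ} [Fact p.Prime] (S₀ : Finset (HeightOneSpectrum (𝓞 ℚ)))

/-- **On the X1 leaf with a CLOSED LEAF relative: `BSD(E₀, p)`, the shift DERIVED.** Target
`(E₀, p)` on the leaf (`X1.RankZero.Leaf`: `ClassX1 ∧ r_an = 0`) with `μ_an = 0`, `λ_an = n`;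
relative `(E₀', p)` good ordinary Eisenstein closed by Mazur's MC with `μ_an = 0`, `λ_an = n'`;
`E₀[p] ≅ E₀'[p]`; `Σ₀ ∌ p` containing the bad primes of both; `k = n' + Σ_{v∈Σ₀} (δ' − δ)` and
`n ≤ k`. Then `BSD(E₀, p)` (`Leaf.bsdp_of_algebraicInvariantsEq`: Greenberg Thm. 4.1, modularity,
GZK). Gen 7's `Leaf.bsdp_of_closedRelative_*` with the typed `CongruentLambdaShift` replaced by
GV's printed (7) / p. 8 / p. 26 and the kernel.
[cite: GreenbergVatsal2000, Thm. (1.4), §2 pp. 26–27] [cite: GreenbergLNM1716, Thm. 4.1]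
[cite: Wuthrich2014, Thm. 16 (p. 397)] -/
theorem Leaf.bsdp_of_closedLeafRelative_of_facts
    (hGV : imKummer_ge_greenbergCondition_at_p) (hA : lambda_nonPrimitive_eq_add_sum_delta)
    (hB : divisible_nonPrimitiveSelmerInfty_of_mu_eq_zero)
    (hW16 : Wuthrich2014.charIdeal_dvd_padicLFunction) (hGr : greenberg_charValue_rankZero)
    (hmod : nonempty_modularParametrizationData)
    (hGZK : rank_eq_analyticRank_of_analyticRank_le_one) (hL : X1.RankZero.Leaf W p) {n : ℕ}
    (hμ0 : X1.MuPart.AnalyticMuLE W p 0) (hlam : X1.ParitySqueeze.AnalyticLambdaEq W p n)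
    (hgood' : W'.HasGoodReductionAtPrime p) (hord' : ¬ (p : ℤ) ∣ W'.frobeniusTrace p)
    (hred' : ¬ W'.HasIrreducibleModPGaloisRep p) (hMC' : MazurMainConjecture W' p) {n' : ℕ}
    (hμ0' : X1.MuPart.AnalyticMuLE W' p 0) (hlam' : X1.ParitySqueeze.AnalyticLambdaEq W' p n')
    (hS₀ : ∀ v ∈ S₀, ((p : ℕ) : 𝓞 ℚ) ∉ v.asIdeal)
    (hS : ∀ v : HeightOneSpectrum (𝓞 ℚ), v ∉ S₀ → ((p : ℕ) : 𝓞 ℚ) ∉ v.asIdeal →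
      W.HasGoodReductionAt v)
    (hS' : ∀ v : HeightOneSpectrum (𝓞 ℚ), v ∉ S₀ → ((p : ℕ) : 𝓞 ℚ) ∉ v.asIdeal →
      W'.HasGoodReductionAt v)
    (hiso : TorsionIso W W' p) {k : ℕ}
    (hk : (k : ℤ) = n' + ∑ v ∈ S₀, ((delta W' p v : ℤ) - (delta W p v : ℤ))) (hn : n ≤ k) :
    BSDp W p :=
  have hX := isClassX1_of_classX1 hL.classX1
  Leaf.bsdp_of_algebraicInvariantsEq hW16 hGr hmod hGZK hL hμ0
    (algebraicInvariantsEq_of_closedLeafRelative_of_facts S₀ hGV hA hB hW16 hmod hX.two_ne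
      hX.hasGoodReductionAtPrime hX.not_dvd_frobeniusTrace hX.not_hasIrreducibleModPGaloisRep hμ0
      hgood' hord' hred' hMC' hμ0' hlam' hS₀ hS hS' hiso hk) hlam hn

end Leaf

end Summit.BirchSwinnertonDyer.Rank1Residual.X2

end
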